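import Summits.AtomisticToContinuum.Crystallization.Theses.PalmUnimodularRigidity
import Summits.AtomisticToContinuum.Crystallization.Theorems.MinimiserShells.Negative.LoadBearing
import Summits.AtomisticToContinuum.Crystallization.Theorems.MinimiserShells.Negative.Normalisation
import Summits.AtomisticToContinuum.Crystallization.Theorems.ChargedEnergyGap.Negative.NoBoundaryReduction
import Summits.AtomisticToContinuum.Crystallization.Theorems.PalmUnimodularRigidityMinimiserShellsDeepBadPricingOfShellNoBoundary
import Literature.Probability.Process.PointStationaryLaw
import Literature.MathematicalPhysics.StatisticalMechanics.LennardJonesClusters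

/-!
# The boundary allowance of the shell gap is not load-bearing (stub `stub_shellNoBoundary_of_shellGapWith`, S10)

Stub S10 of line `equilibrium-in-law-surgery` (reshape r3) of crux `MinimiserShells`
(stmt-AtomisticToContinuum-9225, route `PalmUnimodularRigidity`).

The AMPLIFICATION step for the shell predicate, parallel to
`ChargedEnergyGapNegative.noBoundary_of_gapWith` for the charge predicate: a finite-`N` shell gap
WITH boundary allowance,
`N · e* + κ · #{badly-shelled sites of y} − C₀ · N^(2/3) ≤ 𝓔_N(y)` (all finite injective
`y : Fin N → ℝ³`, some `κ > 0`, `C₀ ∈ ℝ`), implies the allowance-free inequality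
`N · e* + κ · #{badly-shelled sites of y} ≤ 𝓔_N(y)` with the SAME price `κ`.

Proof.  Apply the gap to `M` far translated copies of `y` (`ChargedEnergyGapNegative.copiesFin` at
spacing `L(y) = 8·D(y) + 8`, cross-copy distances `≥ 6·D(y) + 8 ≥ 8`): the energy is at most
`M · 𝓔_N(y)` (`interactionEnergy_copiesFin_le`, `V_LJ ≤ 0` beyond distance `1`), and the number of
badly-shelled sites is EXACTLY `M` times that of `y` (`natCard_bad_copiesFin`), because the shell
predicate `GoodShell` reads only the atoms of the closed ball `B̄(0, 5/4)` of the re-rooted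
configuration (`ShellNoBoundary.goodShell_congr_of_local`) and a point of another copy is `≥ 8`
away (`goodShell_copies_iff`).  Unlike the charge predicate, no hypothesis `N ≥ 2` is needed, so the
cases `N = 0, 1` need no separate treatment.  Taking `M = m³` gives
`m³ · (N·e* + κ·#bad − 𝓔) ≤ C₀ · m² · N^(2/3)` for all `m`, whence the claim (`le_of_key`).
-/

noncomputable section

open MeasureTheory
open scoped ENNReal BigOperators

namespace Summit.AtomisticToContinuum.Crystallization.Theorems.PalmUnimodularRigidityMinimiserShells.ShellGapAmplification

open Literature.MathematicalPhysics.StatisticalMechanics (lennardJones interactionEnergy)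
open Summit.AtomisticToContinuum.Crystallization.Theorems.MinimiserShells.Negative.LoadBearing
  (eStar GoodShell)
open Summit.AtomisticToContinuum.Crystallization.Theorems.ChargedEnergyGapNegative
  (E3 e0 Dsum Dsum_nonneg copies copiesFin copiesFin_apply copiesFin_injective
    interactionEnergy_copiesFin_le spacing one_le_spacing_sub two_Dsum_lt_spacing
    le_dist_copies_ne_spacing cube_mul_rpow)
open Summit.AtomisticToContinuum.Crystallization.Theorems.PalmUnimodularRigidityMinimiserShells.ShellNoBoundary
  (goodShell_congr_of_local count_restrict_image_sub_singleton_ne_zero_iff)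

variable {N : ℕ}

/-! ## Far copies do not change the shell predicate -/

/-- Unfolding `copies` at a pair `(c, i)`: the `i`-th point of the `c`-th copy is
`y i + (c · L) • e₀`. -/
theorem copies_mk (M : ℕ) (L : ℝ) (y : Fin N → E3) (c : Fin M) (i : Fin N) :
    copies M L y (c, i) = y i + (((c : ℕ) : ℝ) * L) • e0 := rfl

/-- **The shell of a site is unchanged in the far copies.**  At spacing `L(y)` the atoms of the
closed ball `B̄(0, 5/4)` of the configuration of copies re-rooted at the point `(c, i)` are exactly
those of `y` re-rooted at `y i` (a point of another copy is at distance `≥ 6·D(y) + 8 > 5/4`), so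
the two shell predicates agree (`goodShell_congr_of_local`). -/
theorem goodShell_copies_iff (M : ℕ) (y : Fin N → E3) (p : Fin M × Fin N) :
    GoodShell ((Measure.count : Measure E3).restrict
        ((fun z => z - copies M (spacing y) y p) '' Set.range (copies M (spacing y) y))) ↔
      GoodShell ((Measure.count : Measure E3).restrict ((fun z => z - y p.2) '' Set.range y)) := by
  obtain ⟨c, i⟩ := p
  refine goodShell_congr_of_local fun w hw => ?_
  rw [count_restrict_image_sub_singleton_ne_zero_iff, count_restrict_image_sub_singleton_ne_zero_iff]
  constructor
  · rintro ⟨⟨c', j⟩, hj⟩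
    have hc : c' = c := by
      by_contra hc
      have hfar := le_dist_copies_ne_spacing M y (p := (c', j)) (q := (c, i)) hc
      rw [hj, dist_eq_norm, add_sub_cancel_right] at hfar
      linarith [Dsum_nonneg y]
    subst hc
    refine ⟨j, ?_⟩
    rw [copies_mk, copies_mk, ← add_assoc] at hj
    exact add_right_cancel hj
  · rintro ⟨j, hj⟩
    refine ⟨(c, j), ?_⟩
    rw [copies_mk, copies_mk, hj, add_assoc]

/-- The re-indexed copies have the same range as the copies. -/
theorem range_copiesFin (M : ℕ) (L : ℝ) (y : Fin N → E3) :
    Set.range (copiesFin M L y) = Set.range (copies M L y) :=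
  finProdFinEquiv.symm.surjective.range_comp _

/-- The shell predicate at a site of `copiesFin` is that of `y` at the corresponding site. -/
theorem goodShell_copiesFin_iff (M : ℕ) (y : Fin N → E3) (a : Fin (M * N)) :
    GoodShell ((Measure.count : Measure E3).restrict
        ((fun z => z - copiesFin M (spacing y) y a) '' Set.range (copiesFin M (spacing y) y))) ↔
      GoodShell ((Measure.count : Measure E3).restrict
        ((fun z => z - y (finProdFinEquiv.symm a).2) '' Set.range y)) := by
  rw [range_copiesFin, copiesFin_apply]
  exact goodShell_copies_iff M y (finProdFinEquiv.symm a)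

/-- **The copies carry `M` times as many badly-shelled sites** (every `N`, no lower bound on `N`). -/
theorem natCard_bad_copiesFin (M : ℕ) (y : Fin N → EuclideanSpace ℝ (Fin 3)) :
    Nat.card {a : Fin (M * N) // ¬ GoodShell ((Measure.count : Measure (EuclideanSpace ℝ (Fin 3))).restrict
        ((fun z => z - copiesFin M (spacing y) y a) '' Set.range (copiesFin M (spacing y) y)))} =
      M * Nat.card {i : Fin N // ¬ GoodShell ((Measure.count : Measure (EuclideanSpace ℝ (Fin 3))).restrict
        ((fun z => z - y i) '' Set.range y))} := by
  have e1 : {a : Fin (M * N) // ¬ GoodShell ((Measure.count : Measure E3).restrict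
        ((fun z => z - copiesFin M (spacing y) y a) '' Set.range (copiesFin M (spacing y) y)))} ≃
      {p : Fin M × Fin N // ¬ GoodShell ((Measure.count : Measure E3).restrict
        ((fun z => z - y p.2) '' Set.range y))} :=
    finProdFinEquiv.symm.subtypeEquiv fun a => not_congr (goodShell_copiesFin_iff M y a)
  have e2 : {p : Fin M × Fin N // ¬ GoodShell ((Measure.count : Measure E3).restrict
        ((fun z => z - y p.2) '' Set.range y))} ≃
      Fin M × {i : Fin N // ¬ GoodShell ((Measure.count : Measure E3).restrict
        ((fun z => z - y i) '' Set.range y))} :=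
    { toFun := fun p => (p.1.1, ⟨p.1.2, p.2⟩)
      invFun := fun q => ⟨(q.1, q.2.1), q.2.2⟩
      left_inv := fun _ => rfl
      right_inv := fun _ => rfl }
  rw [Nat.card_congr (e1.trans e2), Nat.card_prod, Nat.card_eq_fintype_card, Fintype.card_fin]

/-! ## The amplification -/

/-- **Amplification arithmetic.**  If `(M·N)·e + κ·(M·b) − C·(M·N)^(2/3) ≤ M·E` for every
`M : ℕ`, then `N·e + κ·b ≤ E`: take `M = m³`, so that `(m³·N)^(2/3) = m²·N^(2/3)`
(`cube_mul_rpow`), and let `m → ∞`. -/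
theorem le_of_key {e κ C E b : ℝ} {N : ℕ}
    (key : ∀ M : ℕ, ((M : ℝ) * N) * e + κ * ((M : ℝ) * b) - C * ((M : ℝ) * N) ^ (2 / 3 : ℝ) ≤
      (M : ℝ) * E) :
    (N : ℝ) * e + κ * b ≤ E := by
  refine le_of_not_gt fun hlt => ?_
  have hε0 : 0 < (N : ℝ) * e + κ * b - E := by linarith
  obtain ⟨m₀, hm₀⟩ := exists_nat_gt (C * (N : ℝ) ^ (2 / 3 : ℝ) / ((N : ℝ) * e + κ * b - E))
  have hm1 : C * (N : ℝ) ^ (2 / 3 : ℝ) < ((m₀ + 1 : ℕ) : ℝ) * ((N : ℝ) * e + κ * b - E) := by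
    rw [div_lt_iff₀ hε0] at hm₀
    push_cast
    nlinarith
  have hm2 : (0 : ℝ) < (((m₀ + 1 : ℕ) : ℝ)) ^ 2 := by positivity
  have hkey := key ((m₀ + 1) ^ 3)
  push_cast [Nat.cast_pow] at hkey
  push_cast at hm1 hm2
  rw [cube_mul_rpow (by positivity) (Nat.cast_nonneg N)] at hkey
  nlinarith [mul_lt_mul_of_pos_right hm1 hm2, hkey]

/-- **Stub `stub_shellNoBoundary_of_shellGapWith` (S10) of line `equilibrium-in-law-surgery`.**
A finite-`N` shell gap with boundary allowance `C₀ · N^(2/3)` implies the allowance-free shell gap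
with the same price `κ`: apply the gap to `M` far translated copies of `y` (badly-shelled count
`× M` by `natCard_bad_copiesFin`, energy `≤ M · 𝓔_N(y)` by `interactionEnergy_copiesFin_le`) and
amplify (`le_of_key`). -/
theorem stub_shellNoBoundary_of_shellGapWith :
    (∃ κ C₀ : ℝ, 0 < κ ∧ ∀ (N : ℕ) (y : Fin N → EuclideanSpace ℝ (Fin 3)), Function.Injective y →
      (N : ℝ) * eStar + κ * (Nat.card {i : Fin N // ¬ GoodShell
          ((Measure.count : Measure (EuclideanSpace ℝ (Fin 3))).restrict ((fun z => z - y i) '' Set.range y))} : ℝ) -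
        C₀ * (N : ℝ) ^ (2 / 3 : ℝ) ≤ interactionEnergy lennardJones y) →
    ∃ κ : ℝ, 0 < κ ∧ ∀ (N : ℕ) (y : Fin N → EuclideanSpace ℝ (Fin 3)), Function.Injective y →
      (N : ℝ) * eStar + κ * (Nat.card {i : Fin N // ¬ GoodShell
          ((Measure.count : Measure (EuclideanSpace ℝ (Fin 3))).restrict ((fun z => z - y i) '' Set.range y))} : ℝ) ≤
        interactionEnergy lennardJones y := by
  rintro ⟨κ, C₀, hκ, h⟩
  refine ⟨κ, hκ, fun N y hy => le_of_key (C := C₀) fun M => ?_⟩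
  have hg := h (M * N) (copiesFin M (spacing y) y) (copiesFin_injective M (two_Dsum_lt_spacing y) hy)
  rw [natCard_bad_copiesFin M y] at hg
  push_cast at hg
  exact hg.trans (interactionEnergy_copiesFin_le M y (one_le_spacing_sub y))

end Summit.AtomisticToContinuum.Crystallization.Theorems.PalmUnimodularRigidityMinimiserShells.ShellGapAmplification

end
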